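import Summits.ResolutionOfSingularities.ResolutionOfSingularities.Theorems.FrobeniusClosingSteerBinaryResidueWindowKernel
import Literature.AlgebraicGeometry.Resolution.RegularLocalOrder
import Literature.AlgebraicGeometry.Resolution.RegularLocalRingsQuotient
import Mathlib.RingTheory.MvPolynomial.Basic
import Mathlib.Algebra.CharP.Two
import HarnessLib

/-!
# hARᵒ H2 — kernel piece F2: the SATELLITE window lemma (B-side) and the parity lemma
# (characteristic `2`; Theses-free, def-free)

OURS (campaign `res-hironaka`, rung L ★L-G4, slot W4.1 · crux `Steer` (stmt-ResolutionOfSingularities-16345) · hARᵒ slot H2 «a late switch sits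
next to an ON-AXIS BINARY A-stage», res-L0-w41-tri-1 RULING-REPLY 2026-08-27 15:06Z (R2); res-type-062 g15 `H2-DESIGN.md` v1 §2 (b)/(d), §3 F2).
Over res-type-028's `BinaryResidue` pieces (`…Restriction` piece 1 `eq_sq_add_bind₁_of_sub_sq_mem`, `…WindowKernel` §2, `…Assembly` §2) BY NAME.
Not a statement of the manuscript under review [claim: Hironaka2017, status: under-review]; AI-produced, weaker than expert review.

THE SETTING (an ADAPTED RATIONAL point window `S ≤ S' ⊆ L`, `char L = 2`, at a B-stage `S = R_{B₁}` whose point step has exceptional parameter `x`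
(here: `x = x₁`) and whose FIRST adapted parameter `v₀` is the OLD odd divisor — adapted means `v_j = x · v'_j` with `(x, v') ` regular parameters of
`S'`; `v₀ = x_A` is adapted exactly when the next centre lies on the strict transform of `V(x_A)`: the SATELLITE condition of tri-1's (R2)).

* §0 `degree_add_one_eq_of_X_mul_eq_sq_add` — POLYNOMIAL LEMMA P (char `2`): `X₀ · C = q² + R` with `R` a form of degree `D` ⇒ every `X₀`-free
  monomial of `C` has degree `D − 1` (the `X₀¹`-coefficients of a square vanish).
* §1 `exists_sub_mul_sq_mem_pow_of_mul_sub_sq_mem_pow` — PARITY LEMMA: `S` regular local, `x ∈ 𝔪 ∖ 𝔪²`, `x·h − γ² ∈ 𝔪^(2e)` ⇒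
  `∃ q, h − x·q² ∈ 𝔪^(2e−1)` (`γ̄ ∈ 𝔪^e` in the regular ring `S/(x)`, lift, `ord(x·y) = 1 + ord y`).
* §2 **`mem_sup_of_satellite_window`** — THE B-SIDE LEMMA: `h ∈ 𝔪_S^d`, `h' · x^d = h`, and at the later member
  `v'₀ · h' − g'² ∈ 𝔪_{S'}^(d+1) + (x)` for some `g'` (`d + 1 = 2e`) ⇒ `h ∈ (v₀) + (v₁, …, v_n)^d + 𝔪_S^(d+1)`.
  (Taylor polynomial `C` of `h` with `h' = C(v')`; in `O = S'/(x)`: `v̄'₀·C̄(v̄') ≡ ḡ'²  (mod 𝔪_O^(d+1))`; piece 1 with all coordinates ⇒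
  `X₀·C̄ = q² + R`; lemma P; split the homogenised Taylor sum by «contains `v₀`» / «`v₀`-free of degree `d`» / «`v₀`-free of lower degree, coefficient
  in `𝔪_S`».) USE (res-type-062 H2 case (i)/(ii)): window (B₁, B₂), `h = h̃′` the corrected weak transform of the A-stage radicand, output = the input
  of F1 `mem_sup_of_window` at the window (A*, B₁) with `m = 2`.
[cite: Matsumura1987, Thm. 14.2, Thm. 17.10] [folklore]
-/

noncomputable section

-- `Summit.<S>.<S>.…` duplicates the summit name by design (single-problem summit).
set_option linter.dupNamespace false

open IsLocalRing MvPolynomial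

namespace Summit.ResolutionOfSingularities.ResolutionOfSingularities.Theorems.SwitchingDichotomy.BinaryResidue

open Literature.AlgebraicGeometry.Resolution

universe u v

/-! ## §0 Polynomial lemma P: `X₀ · C = q² + R_D` in characteristic `2` -/

section poly

variable {κ : Type u} [CommRing κ]

/-- In characteristic `2` the coefficient of a monomial with an ODD exponent in a square vanishes (`q² = Σ q_α² T^(2α)`). [folklore] -/
theorem coeff_sq_eq_zero_of_odd [CharP κ 2] {σ : Type*} (q : MvPolynomial σ κ) {m : σ →₀ ℕ} {i : σ} (hi : Odd (m i)) :
    (q ^ 2).coeff m = 0 := by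
  classical
  conv_lhs => rw [q.as_sum, CharTwo.sum_sq]
  rw [coeff_sum]
  refine Finset.sum_eq_zero fun α _ => ?_
  rw [monomial_pow, coeff_monomial, if_neg]
  intro h
  have : (2 • α) i = m i := by rw [h]
  rw [Finsupp.smul_apply, smul_eq_mul] at this
  exact (Nat.not_even_iff_odd.mpr hi) ⟨α i, by omega⟩

/-- **Polynomial lemma P.** Characteristic `2`: if `X i₀ · C = q² + R` with `R` homogeneous of degree `D`, then every monomial `β` in the support
of `C` with `β i₀ = 0` has degree `D − 1` (precisely `β.degree + 1 = D`): the coefficient of `T^β · X i₀` in `q²` vanishes (odd exponent at `i₀`),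
so it is the coefficient in `R`. [folklore] -/
theorem degree_add_one_eq_of_X_mul_eq_sq_add [CharP κ 2] {n : ℕ} (i₀ : Fin n) {C q R : MvPolynomial (Fin n) κ} {D : ℕ}
    (hR : R.IsHomogeneous D) (hid : X i₀ * C = q ^ 2 + R) {β : Fin n →₀ ℕ} (hβ : β ∈ C.support) (hβ0 : β i₀ = 0) :
    β.degree + 1 = D := by
  classical
  set m : Fin n →₀ ℕ := β + Finsupp.single i₀ 1 with hm
  have hcoeff : (X i₀ * C).coeff m = C.coeff β := by
    rw [coeff_X_mul', if_pos (by simp [hm]), hm, add_tsub_cancel_right]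
  have hq : (q ^ 2).coeff m = 0 := coeff_sq_eq_zero_of_odd q (i := i₀) (by simp [hm, hβ0])
  have hRm : R.coeff m ≠ 0 := by
    intro h0
    have : C.coeff β = 0 := by rw [← hcoeff, hid, coeff_add, hq, h0, add_zero]
    exact (mem_support_iff.mp hβ) this
  have hdeg := hR hRm
  rw [Finsupp.weight_apply] at hdeg
  simp only [Pi.one_apply, smul_eq_mul, mul_one] at hdeg
  have hmdeg : m.degree = β.degree + 1 := by
    rw [hm, map_add, Finsupp.degree_single]
  rw [← hmdeg, ← hdeg, Finsupp.degree_apply]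
  rfl

end poly

/-! ## §1 The parity lemma -/

section parity

variable {S : Type u} [CommRing S] [IsRegularLocalRing S]

/-- **Parity lemma.** `S` regular local of characteristic `2` (`2 = 0`), `x ∈ 𝔪 ∖ 𝔪²`, `x·h − γ² ∈ 𝔪^(2e)` with `1 ≤ e` ⇒ `h − x·q² ∈ 𝔪^(2e−1)` for some
`q`. Proof: in the regular local ring `O = S/(x)`, `γ̄² ∈ 𝔪_O^(2e)` forces `γ̄ ∈ 𝔪_O^e` (orders add); lift `γ = γ₀ + x·γ₁` with `γ₀ ∈ 𝔪^e`; then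
`x·(h − x·γ₁²) = (x·h − γ²) + γ₀² ∈ 𝔪^(2e)` and `ord x = 1` give the claim. [cite: ZariskiSamuel1960, Ch. VIII §1 Thm. 1] [cite: Matsumura1987, Thm. 14.2] -/
theorem exists_sub_mul_sq_mem_pow_of_mul_sub_sq_mem_pow (h2 : (2 : S) = 0) {x : S} (hxm : x ∈ maximalIdeal S)
    (hx2 : x ∉ maximalIdeal S ^ 2) {e : ℕ} (he : 1 ≤ e) {h γ : S} (hrel : x * h - γ ^ 2 ∈ maximalIdeal S ^ (2 * e)) :
    ∃ q : S, h - x * q ^ 2 ∈ maximalIdeal S ^ (2 * e - 1) := by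
  classical
  set I : Ideal S := Ideal.span {x} with hI
  haveI hO : IsRegularLocalRing (S ⧸ I) := (IsRegularLocalRing.quotient_span_singleton hxm hx2).1
  set mk : S →+* S ⧸ I := Ideal.Quotient.mk I with hmk
  have hmkx : mk x = 0 := Ideal.Quotient.eq_zero_iff_mem.mpr (Ideal.mem_span_singleton_self x)
  have hmO : ∀ k, Ideal.map mk (maximalIdeal S ^ k) = maximalIdeal (S ⧸ I) ^ k := fun k => by
    rw [Ideal.map_pow, map_maximalIdeal_of_surjective mk Ideal.Quotient.mk_surjective]
  -- `γ̄² ∈ 𝔪_O^(2e)`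
  have hγ2 : mk γ ^ 2 ∈ maximalIdeal (S ⧸ I) ^ (2 * e) := by
    have := Ideal.mem_map_of_mem mk hrel
    rw [hmO, map_sub, map_mul, hmkx, zero_mul, zero_sub, map_pow, neg_mem_iff] at this
    exact this
  -- hence `γ̄ ∈ 𝔪_O^e`
  have hγe : mk γ ∈ maximalIdeal (S ⧸ I) ^ e := by
    by_contra hne
    obtain ⟨e', rfl⟩ : ∃ e', e = e' + 1 := ⟨e - 1, by omega⟩
    have := pow_not_mem_pow_of_not_mem_pow (R := S ⧸ I) hne 2
    rw [show 2 * e' + 1 = 2 * (e' + 1) - 1 by omega] at this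
    exact this (Ideal.pow_le_pow_right (by omega) hγ2)
  -- lift: `γ = γ₀ + x·γ₁` with `γ₀ ∈ 𝔪^e`
  rw [← hmO, Ideal.mem_map_iff_of_surjective mk Ideal.Quotient.mk_surjective] at hγe
  obtain ⟨γ₀, hγ₀, hγ₀eq⟩ := hγe
  have hdiff : γ - γ₀ ∈ I := by
    rw [← Ideal.Quotient.eq, ← hmk]; exact hγ₀eq.symm
  obtain ⟨γ₁, hγ₁⟩ := Ideal.mem_span_singleton'.mp hdiff
  refine ⟨γ₁, ?_⟩
  -- `x·(h − x·γ₁²) = (x·h − γ²) + γ₀²`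
  have hid : x * (h - x * γ₁ ^ 2) = (x * h - γ ^ 2) + γ₀ ^ 2 := by
    have hγ : γ = γ₀ + γ₁ * x := by rw [hγ₁]; ring
    rw [hγ]
    linear_combination (γ₀ * γ₁ * x) * h2
  have hmem : x * (h - x * γ₁ ^ 2) ∈ maximalIdeal S ^ (2 * e) := by
    rw [hid]
    refine add_mem hrel ?_
    have := Ideal.pow_mem_pow hγ₀ 2
    rw [← pow_mul, mul_comm] at this
    exact this
  by_contra hnot
  have hx1 : x ∉ maximalIdeal S ^ (1 + 1) := hx2
  have := mul_not_mem_pow_of_not_mem_pow (R := S) hx1 (q := 2 * e - 2)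
    (by rw [show 2 * e - 2 + 1 = 2 * e - 1 by omega]; exact hnot)
  rw [show 1 + (2 * e - 2) + 1 = 2 * e by omega] at this
  exact this hmem

end parity

/-! ## §2 The satellite window lemma -/

section kernel

variable {L : Type} [Field L]

/-- **The satellite window lemma (B-side).** Adapted rational window `S ≤ S' ⊆ L` of characteristic `2` with window parameter `x` and adapted
parameters `v : Fin (n+1) → S`, `v_j = x·v'_j`; `h ∈ 𝔪_S^d` with weak transform `h'` (`h'·x^d = h`), `d + 1 = 2e`. If
`v'₀ · h' − g'² ∈ 𝔪_{S'}^(d+1) + (x)` for some `g' ∈ S'` (the later member has cleaned order `≥ d+1` and the member is `v'₀·h'` up to squares —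
the SATELLITE configuration), then `h ∈ (v₀) + (v₁, …, v_n)^d + 𝔪_S^(d+1)`. [cite: Matsumura1987, Thm. 14.2, Thm. 17.10] [folklore] -/
theorem mem_sup_of_satellite_window (h2 : (2 : L) = 0) (S S' : Subring L) [IsLocalRing S] [IsLocalRing S']
    (hle : S ≤ S') (hreg' : IsRegularLocalRing S') {n : ℕ} (hdim' : ringKrullDim S' = (n + 1 + 1 : ℕ))
    (x : S) (hx0 : (x : L) ≠ 0) (v : Fin (n + 1) → S) (hxv : Ideal.span (insert x (Set.range v)) = maximalIdeal S)
    (v' : Fin (n + 1) → S') (hv : ∀ j, ((v j : S) : L) = (x : L) * ((v' j : S') : L))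
    (hm' : Ideal.span (insert (⟨(x : L), hle x.2⟩ : S') (Set.range v')) = maximalIdeal S')
    (hrat : ∀ a : S', ∃ b : S, a - ⟨(b : L), hle b.2⟩ ∈ maximalIdeal S')
    {d e : ℕ} (hde : d + 1 = 2 * e) (h : S) (hhd : h ∈ maximalIdeal S ^ d) (h' : S')
    (hlaw : ((h' : S') : L) * (x : L) ^ d = ((h : S) : L))
    (hyp : ∃ g' : S', v' 0 * h' - g' ^ 2 ∈ maximalIdeal S' ^ (d + 1) ⊔ Ideal.span {(⟨(x : L), hle x.2⟩ : S')}) :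
    h ∈ Ideal.span {v 0} ⊔ Ideal.span (Set.range fun j : Fin n => v j.succ) ^ d ⊔ maximalIdeal S ^ (d + 1) := by
  classical
  set x' : S' := ⟨(x : L), hle x.2⟩ with hx'def
  set I : Ideal S' := Ideal.span (Set.range ![x']) with hIdef
  have hx'I : x' ∈ I := Ideal.subset_span ⟨0, rfl⟩
  have hIx : I = Ideal.span {x'} := by
    rw [hIdef]; congr 1; ext a; simp
  -- the quotient `O`
  obtain ⟨hO, hn, hū⟩ := quotient_span_singleton_rsop hreg' x' v' hm' hdim'
  set O := S' ⧸ I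
  set mk : S' →+* O := Ideal.Quotient.mk I with hmkdef
  set ū : Fin (n + 1) → O := mk ∘ v' with hūdef
  haveI : IsRegularLocalRing O := hO
  set incl : S →+* S' := Subring.inclusion hle with hincl
  have hxm : x ∈ maximalIdeal S := hxv ▸ Ideal.subset_span (Set.mem_insert _ _)
  have hvm : ∀ j, v j ∈ maximalIdeal S := fun j => hxv ▸ Ideal.subset_span (Set.mem_insert_of_mem _ ⟨j, rfl⟩)
  have hincl_v : ∀ j, incl (v j) = x' * v' j := fun j =>
    Subtype.ext (by rw [hincl, Subring.coe_inclusion]; exact hv j)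
  have hker : ∀ a ∈ maximalIdeal S, (mk.comp incl) a = 0 := by
    intro a ha
    rw [← hxv] at ha
    rw [RingHom.comp_apply, hmkdef, Ideal.Quotient.eq_zero_iff_mem]
    refine Submodule.span_induction ?_ (by simp) (fun a b _ _ ha hb => ?_) (fun r a _ ha => ?_) ha
    · rintro a (rfl | ⟨j, rfl⟩)
      · exact hx'I
      · rw [hincl_v j]
        exact I.mul_mem_right _ hx'I
    · rw [map_add]; exact add_mem ha hb
    · rw [smul_eq_mul, map_mul]; exact I.mul_mem_left _ ha
  set ι₀ : ResidueField S →+* O := Ideal.Quotient.lift (maximalIdeal S) (mk.comp incl) hker with hι₀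
  letI : Algebra (ResidueField S) O := ι₀.toAlgebra
  have hι₀res : ∀ b : S, algebraMap (ResidueField S) O (residue S b) = mk (incl b) := fun b => by
    show ι₀ (residue S b) = _
    rw [hι₀]; rfl
  have hratO : ∀ o : O, ∃ c : ResidueField S, o - algebraMap (ResidueField S) O c ∈ maximalIdeal O := by
    intro o
    obtain ⟨a, rfl⟩ := Ideal.Quotient.mk_surjective (I := I) o
    obtain ⟨b, hb⟩ := hrat a
    refine ⟨residue S b, ?_⟩
    rw [hι₀res, ← map_maximalIdeal_of_surjective mk Ideal.Quotient.mk_surjective]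
    change mk a - mk (incl b) ∈ _
    rw [← map_sub]
    exact Ideal.mem_map_of_mem _ hb
  have h2S' : (2 : S') = 0 := by
    apply Subtype.ext
    change S'.subtype 2 = S'.subtype 0
    rw [map_ofNat, map_zero]; exact h2
  have h2O : (2 : O) = 0 := by rw [← map_ofNat mk 2, h2S', map_zero]
  have h2S : (2 : S) = 0 := by
    apply Subtype.ext
    change S.subtype 2 = S.subtype 0
    rw [map_ofNat, map_zero]; exact h2
  have h2κ : (2 : ResidueField S) = 0 := by rw [← map_ofNat (residue S) 2, h2S, map_zero]
  haveI : CharP (ResidueField S) 2 := CharTwo.of_one_ne_zero_of_two_eq_zero one_ne_zero h2κ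
  -- the hypothesis in `O`: `ū₀ · mk h' − (mk g')² ∈ 𝔪_O^(d+1)`
  obtain ⟨g', hg'⟩ := hyp
  have hO1 : ū 0 * mk h' - mk g' ^ 2 ∈ maximalIdeal O ^ (d + 1) := by
    have := Ideal.mem_map_of_mem mk hg'
    rw [Ideal.map_sup, Ideal.map_pow, map_maximalIdeal_of_surjective mk Ideal.Quotient.mk_surjective, Ideal.map_span,
      Set.image_singleton, (Ideal.Quotient.eq_zero_iff_mem.mpr hx'I : mk x' = 0), Ideal.span_singleton_zero, sup_bot_eq,
      map_sub, map_pow, map_mul] at this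
    exact this
  -- the degree-`d` Taylor polynomial `C` of `h` with `h' = C(v')`
  set xv : Fin (n + 1 + 1) → S := Fin.cons x v with hxvdef
  have hhd' : h ∈ Ideal.span (Set.range xv) ^ d := by
    rwa [hxvdef, Fin.range_cons, hxv]
  obtain ⟨Φ, hΦ, hΦev⟩ := exists_isHomogeneous_of_mem_span_pow xv d hhd'
  set C : MvPolynomial (Fin (n + 1)) S := bind₁ (Fin.cons 1 X : Fin (n + 1 + 1) → MvPolynomial (Fin (n + 1)) S) Φ with hCdef
  have hC : C.totalDegree ≤ d := by
    refine (totalDegree_bind₁_le_of_le_one (fun i => ?_) Φ).trans hΦ.totalDegree_le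
    refine Fin.cases ?_ (fun j => ?_) i
    · simp
    · simp [totalDegree_X]
  set vL : Fin (n + 1) → L := fun j => ((v' j : S') : L) with hvL
  have hcons : (⇑S.subtype ∘ xv) = (x : L) • (Fin.cons 1 vL : Fin (n + 1 + 1) → L) := by
    funext i
    refine Fin.cases ?_ (fun j => ?_) i
    · simp [hxvdef]
    · simp [hxvdef, hvL, hv j]
  have hfun : (fun i => eval₂Hom S.subtype vL ((Fin.cons 1 X : Fin (n + 1 + 1) → MvPolynomial (Fin (n + 1)) S) i)) =
      (Fin.cons 1 vL : Fin (n + 1 + 1) → L) := by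
    funext i
    refine Fin.cases ?_ (fun j => ?_) i
    · simp
    · simp
  have hevC : eval₂ S.subtype vL C = eval₂ S.subtype (Fin.cons 1 vL : Fin (n + 1 + 1) → L) Φ := by
    rw [hCdef]
    change eval₂Hom S.subtype vL (bind₁ (Fin.cons 1 X) Φ) = eval₂Hom S.subtype (Fin.cons 1 vL) Φ
    rw [eval₂Hom_bind₁, hfun]
  have hF : S.subtype h = S.subtype x ^ d * eval₂ S.subtype vL C := by
    rw [← hΦev, show eval xv Φ = eval₂ (RingHom.id S) xv Φ from rfl,
      eval₂_comp_left, RingHom.comp_id, hcons, eval₂_smul_eq S.subtype hΦ, hevC]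
    rfl
  have hh'L : ((h' : S') : L) = eval₂ S.subtype vL C := by
    have h1 : ((h' : S') : L) * (x : L) ^ d = (x : L) ^ d * eval₂ S.subtype vL C := by
      rw [hlaw]; exact hF
    have hxd : (x : L) ^ d ≠ 0 := pow_ne_zero _ hx0
    calc ((h' : S') : L) = ((h' : S') : L) * (x : L) ^ d / (x : L) ^ d := by field_simp
      _ = eval₂ S.subtype vL C := by rw [h1]; field_simp
  have hh'S' : h' = eval₂ incl v' C := by
    apply Subtype.ext
    rw [hh'L, show ((eval₂ incl v' C : S') : L) = S'.subtype (eval₂ incl v' C) from rfl, eval₂_comp_left]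
    rfl
  have hmkh' : mk h' = aeval ū (map (residue S) C) := by
    rw [hh'S', eval₂_comp_left, aeval_def, eval₂_map]
    congr 1
  -- piece 1 in `O` with all the coordinates: `X₀ · C̄ = q² + R`
  set Cbar : MvPolynomial (Fin (n + 1)) (ResidueField S) := map (residue S) C with hCbar
  have hCbar_deg : Cbar.totalDegree ≤ d := le_trans (Finset.sup_mono (support_map_subset _ _)) hC
  have hXC_deg : (X 0 * Cbar).totalDegree ≤ d + 1 :=
    (totalDegree_mul _ _).trans (by rw [totalDegree_X]; omega)
  have hℓX : ∀ i : Fin (n + 1), (X i : MvPolynomial (Fin (n + 1)) (ResidueField S)).IsHomogeneous 1 := fun i => isHomogeneous_X _ i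
  have hspanX : Ideal.span (Set.range fun i : Fin (n + 1) => aeval ū (X i : MvPolynomial (Fin (n + 1)) (ResidueField S))) =
      maximalIdeal O := by
    simp only [aeval_X]
    exact hū
  have hO2 : aeval ū (X 0 * Cbar) - mk g' ^ 2 ∈
      Ideal.span (Set.range fun i : Fin (n + 1) => aeval ū (X i : MvPolynomial (Fin (n + 1)) (ResidueField S))) ^ (d + 1) ⊔
        maximalIdeal O ^ (d + 1 + 1) := by
    rw [hspanX, map_mul, aeval_X, ← hmkh']
    exact Ideal.mem_sup_left hO1
  obtain ⟨q, -, R, hR, hid⟩ := eq_sq_add_bind₁_of_sub_sq_mem h2O hn ū hū hratO hde (X 0 * Cbar) hXC_deg (mk g') X hℓX hO2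
  have hid' : X 0 * Cbar = q ^ 2 + R := by
    rw [hid, show bind₁ X R = R from by rw [bind₁_X_left]; rfl]
  -- lemma P: the `X₀`-free monomials of `C̄` have degree `d`
  have hP : ∀ β ∈ Cbar.support, β 0 = 0 → β.degree = d := by
    intro β hβ hβ0
    have := degree_add_one_eq_of_X_mul_eq_sq_add (0 : Fin (n + 1)) hR hid' hβ hβ0
    omega
  -- the homogenised Taylor sum `h = Σ_β c_β x^(d−|β|) v^β`
  have hsum : h = ∑ β ∈ C.support, C.coeff β * x ^ (d - β.degree) * β.prod fun j k => v j ^ k := by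
    have hι := map_sum_homogenised_eq S.subtype x v vL (fun j => hv j) C hC
    refine Subtype.coe_injective ?_
    change S.subtype h = S.subtype (∑ β ∈ C.support, C.coeff β * x ^ (d - β.degree) * β.prod fun j k => v j ^ k)
    rw [hι, hF]
  rw [hsum]
  refine Ideal.sum_mem _ fun β hβ => ?_
  have hβdeg : β.degree ≤ d := (le_totalDegree hβ : β.degree ≤ _).trans hC
  by_cases hβ0 : β 0 = 0
  · by_cases hdeg : β.degree = d
    · -- `v₀`-free of degree `d`: a monomial in `v ∘ succ` of degree `d`
      refine Ideal.mem_sup_left (Ideal.mem_sup_right ?_)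
      rw [hdeg, Nat.sub_self, pow_zero, mul_one]
      refine Ideal.mul_mem_left _ _ ?_
      have hprod : (β.prod fun j k => v j ^ k) = ∏ j : Fin n, v j.succ ^ β j.succ := by
        rw [Finsupp.prod_fintype _ _ (fun j => by simp), Fin.prod_univ_succ, hβ0, pow_zero, one_mul]
      rw [hprod]
      have hdeg' : ∑ j : Fin n, β j.succ = d := by
        have : β.degree = ∑ j : Fin (n + 1), β j := Finsupp.degree_eq_sum β
        rw [this, Fin.sum_univ_succ, hβ0, zero_add] at hdeg
        exact hdeg
      rw [← hdeg', ← Finset.prod_pow_eq_pow_sum]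
      exact Ideal.prod_mem_prod fun j _ => Ideal.pow_mem_pow (Ideal.subset_span (Set.mem_range_self j)) _
    · -- `v₀`-free of lower degree: the coefficient lies in `𝔪_S`
      refine Ideal.mem_sup_right ?_
      have hcoeff : C.coeff β ∈ maximalIdeal S := by
        rw [← residue_eq_zero_iff, ← coeff_map]
        by_contra hne
        exact hdeg (hP β (mem_support_iff.mpr hne) hβ0)
      have hprod : (β.prod fun j k => v j ^ k) ∈ maximalIdeal S ^ β.degree := by
        rw [Finsupp.prod, show β.degree = ∑ i ∈ β.support, β i from rfl, ← Finset.prod_pow_eq_pow_sum]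
        exact Ideal.prod_mem_prod fun j _ => Ideal.pow_mem_pow (hvm j) _
      have : maximalIdeal S ^ (d + 1) = maximalIdeal S * maximalIdeal S ^ (d - β.degree) * maximalIdeal S ^ β.degree := by
        rw [mul_assoc, ← pow_add, Nat.sub_add_cancel hβdeg, pow_succ']
      rw [this]
      exact Ideal.mul_mem_mul (Ideal.mul_mem_mul hcoeff (Ideal.pow_mem_pow hxm _)) hprod
  · -- contains `v₀`
    refine Ideal.mem_sup_left (Ideal.mem_sup_left ?_)
    have h0mem : (0 : Fin (n + 1)) ∈ β.support := Finsupp.mem_support_iff.mpr hβ0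
    have hdvd : v 0 ∣ β.prod fun j k => v j ^ k := by
      rw [Finsupp.prod, ← Finset.mul_prod_erase _ _ h0mem]
      exact Dvd.dvd.mul_right (dvd_pow_self _ hβ0) _
    exact Ideal.mul_mem_left _ _ (Ideal.mem_span_singleton.mpr hdvd)

end kernel

end Summit.ResolutionOfSingularities.ResolutionOfSingularities.Theorems.SwitchingDichotomy.BinaryResidue

end
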